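import Summits.KontsevichZagierPeriods.KontsevichZagierPeriods.Theorems.LinRedNormalFormArrangementNormalFormStubRebaseSimplePosOnePosDCornerPar
import Summits.KontsevichZagierPeriods.KontsevichZagierPeriods.Theorems.LinRedNormalFormArrangementNormalFormStubRebaseSimplePosOnePosParThinQuadCell

/-!
# Stub `stub_rebaseSimplePosOnePos` (crux `ArrangementNormalForm`, line `janus-bands`) —
part `OfHUQ`: the stub in every dimension from the thin-cell residues alone

By part `DCornerPar` the double-corner hypotheses `Hdthick`, `Hdfar` of
`rebaseSimplePosOnePos_of_thinQuad'` (part `ParThinQuadCell`) follow from `Hpar`, which by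
`RebasePos.good_par_of_thinQuad` follows from the thin-cell residues `HUQ` (the `ε`-thin far-side
product cells with a triple point at pole distance `≥ δ`, or with a quadruple point). Hence, for
EVERY `b` (`rebaseSimplePosOnePos_of_HUQ'`, exactly the stub's signature plus `ε`, `hε`, `HUQ`):
`GS (b+2) 1 → closure (GG (b+2) 2 1 ∪ JJ (b+2) 2 ∪ JD (b+3))` modulo `KZ.relations` as soon as
`HUQ` holds at base dimension `b + 2`. At `b = 0` both branches of `HUQ` are discharged (parts
`QuadFinal`, `HUFinal`). Registered as `rebaseSimplePos_dthick_of_HUQ` (the double corner from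
`HUQ`, every base dimension).

References: M. Kontsevich, D. Zagier, *Periods* (2001), §1.2, rules (1a), (1b), (2).
-/

noncomputable section

open Set MeasureTheory MvPolynomial
open Literature.NumberTheory.Transcendental Literature.ModelTheory.ExponentialFields

namespace Summit.KontsevichZagierPeriods.ArrangementNormalForm.JanusBands

namespace RebasePos

open SeparatePos

section OfHUQ

variable {B m m' : ℕ} (L : Fin m → (Fin B → ℚ) × ℚ) (e : Fin m → ℕ) (ℓ₁ ℓ₂ : (Fin B → ℚ) × ℚ)

/-- **`Hdthick` from the thin-cell residues `HU`, `HQ`, every base dimension** (`good_dthick_of_par`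
+ `good_par_of_thinQuad`). -/
theorem good_dthick_of_HUQ (ε : ℚ) (hε : 0 < ε) (s : KZ.IntegralRep (B + 1 + 1)) (M : Fin m' → (Fin (B + 1) → ℚ) × ℚ)
    (p : MvPolynomial (Fin B) ℚ) (u v κ : (Fin (B + 1) → ℚ) × ℚ) (A : ℚ)
    (hbd : Bornology.IsBounded s.domain)
    (hdom : s.domain = gDom B 1 m' M (fun _ => Sum.inr u) (fun _ => Sum.inr v))
    (hint : EqOn s.integrand (glit B 1 p L e ℓ₁ ℓ₂ 0 1 (fun _ => some 0)) s.domain)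
    (hκ : κ.1 (Fin.last B) = 0) (hA : u - κ = A • (v - u)) (hA0 : 0 < A)
    (hcell : ∀ z : Fin (B + 1 + 1) → ℝ, (∀ j, 0 < affF B 1 (M j) z) →
      affF B 1 κ z < 0 ∧ 0 < affF B 1 u z ∧ affF B 1 u z < affF B 1 v z)
    (HUQ : ∀ (u' v' : (Fin (B + 1) → ℚ) × ℚ), u'.1 (Fin.last B) ≠ 0 → u'.1 (Fin.last B) = v'.1 (Fin.last B) →
      ∀ (m'' m₀' : ℕ) (s' : KZ.IntegralRep (B + 1 + 1)) (M' : Fin m'' → (Fin (B + 1) → ℚ) × ℚ)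
      (M₀' : Fin m₀' → (Fin B → ℚ) × ℚ) (ylo' yhi' : (Fin B → ℚ) × ℚ), Bornology.IsBounded s'.domain →
      s'.domain = gDom B 1 m'' M' (fun _ => Sum.inr u') (fun _ => Sum.inr v') →
      EqOn s'.integrand (glit B 1 p L e ℓ₁ ℓ₂ 0 1 (fun _ => some 0)) s'.domain →
      (∀ z : Fin (B + 1 + 1) → ℝ, (∀ j, 0 < affF B 1 (M' j) z) → 0 < affF B 1 u' z ∧ affF B 1 u' z < affF B 1 v' z) →
      (∀ z : Fin (B + 1 + 1) → ℝ, (∀ j, 0 < affF B 1 (M' j) z) ↔ ((∀ j, 0 < affB B 1 (M₀' j) z) ∧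
        affB B 1 ylo' z < z (Fin.castAdd 1 (Fin.last B)) ∧ z (Fin.castAdd 1 (Fin.last B)) < affB B 1 yhi' z)) →
      (∀ z : Fin (B + 1 + 1) → ℝ, (∀ j, 0 < affB B 1 (M₀' j) z) → affB B 1 ylo' z < affB B 1 yhi' z) →
      (∀ z : Fin (B + 1 + 1) → ℝ, (∀ j, 0 < affB B 1 (M₀' j) z) →
        (0 < u'.1 (Fin.last B) → affB B 1 ℓ₂ z ≤ affB B 1 ylo' z) ∧ (u'.1 (Fin.last B) < 0 → affB B 1 yhi' z ≤ affB B 1 ℓ₂ z)) →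
      (∀ z : Fin (B + 1 + 1) → ℝ, (∀ j, 0 < affB B 1 (M₀' j) z) →
        affF B 1 v' z - affF B 1 u' z < ε * (affB B 1 yhi' z - affB B 1 ylo' z)) →
      ((∃ δ : ℝ, 0 < δ ∧ ∀ z : Fin (B + 1 + 1) → ℝ, (∀ j, 0 < affB B 1 (M₀' j) z) →
        δ ≤ |affB B 1 ylo' z - affB B 1 ℓ₂ z| ∧ δ ≤ |affB B 1 yhi' z - affB B 1 ℓ₂ z|) ∧
       (∃ z ∈ closure {z : Fin (B + 1 + 1) → ℝ | ∀ j, 0 < affF B 1 (M' j) z},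
        affB B 1 ylo' z = affB B 1 yhi' z ∧ affF B 1 u' z = affF B 1 v' z ∧
          affB B 1 (restr B u') z + (u'.1 (Fin.last B) : ℝ) * affB B 1 ℓ₂ z = 0) ∨
       (∃ z ∈ closure {z : Fin (B + 1 + 1) → ℝ | ∀ j, 0 < affF B 1 (M' j) z},
        affB B 1 ylo' z = affB B 1 yhi' z ∧ affF B 1 u' z = affF B 1 v' z ∧
          affB B 1 (restr B u') z + (u'.1 (Fin.last B) : ℝ) * affB B 1 ℓ₂ z = 0 ∧ affB B 1 ylo' z = affB B 1 ℓ₂ z)) →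
      ∃ c ∈ AddSubgroup.closure (GGset B 2 1), KZ.of s' - c ∈ KZ.relations) :
    ∃ c ∈ AddSubgroup.closure (GGset B 2 1), KZ.of s - c ∈ KZ.relations :=
  good_dthick_of_par L e ℓ₁ ℓ₂ s M p u v κ A hbd hdom hint hκ hA hA0 hcell
    fun _ s' M' u' v' hbd' hdom' hint' hu' hpar' hcell' =>
      good_par_of_thinQuad L e ℓ₁ ℓ₂ ε hε s' M' p u' v' hbd' hdom' hint' hu' hpar' hcell'
        (fun m'' m₀' s'' M'' M₀' ylo' yhi' hbd'' hdom'' hint'' hcell'' hsec' hne' hfar' hthin' hδ htr =>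
          HUQ u' v' hu' hpar' m'' m₀' s'' M'' M₀' ylo' yhi' hbd'' hdom'' hint'' hcell'' hsec' hne' hfar' hthin'
            (Or.inl ⟨hδ, htr⟩))
        (fun m'' m₀' s'' M'' M₀' ylo' yhi' hbd'' hdom'' hint'' hcell'' hsec' hne' hfar' hthin' hq =>
          HUQ u' v' hu' hpar' m'' m₀' s'' M'' M₀' ylo' yhi' hbd'' hdom'' hint'' hcell'' hsec' hne' hfar' hthin'
            (Or.inr hq))

end OfHUQ

end RebasePos

/-- **Registered part of `stub_rebaseSimplePosOnePos` (line `janus-bands`): the double corner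
from the thin-cell residues, every base dimension** (`RebasePos.good_dthick_of_HUQ`: the residual
hypothesis `Hdthick` follows from `HU` and `HQ` for the parallel bands with the same base factor). -/
theorem rebaseSimplePos_dthick_of_HUQ (B m m' : ℕ) (L : Fin m → (Fin B → ℚ) × ℚ) (e : Fin m → ℕ) (ℓ₁ ℓ₂ : (Fin B → ℚ) × ℚ) (ε : ℚ) (hε : 0 < ε) (s : KZ.IntegralRep (B + 1 + 1)) (M : Fin m' → (Fin (B + 1) → ℚ) × ℚ) (p : MvPolynomial (Fin B) ℚ) (u v κ : (Fin (B + 1) → ℚ) × ℚ) (A : ℚ) (hbd : Bornology.IsBounded s.domain) (hdom : s.domain = SeparatePos.gDom B 1 m' M (fun _ => Sum.inr u) (fun _ => Sum.inr v)) (hint : Set.EqOn s.integrand (RebasePos.glit B 1 p L e ℓ₁ ℓ₂ 0 1 (fun _ => some 0)) s.domain) (hκ : κ.1 (Fin.last B) = 0) (hA : u - κ = A • (v - u)) (hA0 : 0 < A) (hcell : ∀ z : Fin (B + 1 + 1) → ℝ, (∀ j, 0 < SeparatePos.affF B 1 (M j) z) → SeparatePos.affF B 1 κ z < 0 ∧ 0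 < SeparatePos.affF B 1 u z ∧ SeparatePos.affF B 1 u z < SeparatePos.affF B 1 v z) (HUQ : ∀ (u' v' : (Fin (B + 1) → ℚ) × ℚ), u'.1 (Fin.last B) ≠ 0 → u'.1 (Fin.last B) = v'.1 (Fin.last B) → ∀ (m'' m₀' : ℕ) (s' : KZ.IntegralRep (B + 1 + 1)) (M' : Fin m'' → (Fin (B + 1) → ℚ) × ℚ) (M₀' : Fin m₀' → (Fin B → ℚ) × ℚ) (ylo' yhi' : (Fin B → ℚ) × ℚ), Bornology.IsBounded s'.domain → s'.domain = SeparatePos.gDom B 1 m'' M' (fun _ => Sum.inr u') (fun _ => Sum.inr v') → Set.EqOn s'.integrand (RebasePos.glit B 1 p L e ℓ₁ ℓ₂ 0 1 (fun _ => some 0)) s'.domain → (∀ z : Fin (B + 1 + 1) → ℝ, (∀ j, 0 < SeparatePos.affF B 1 (M' j) z) → 0 < SeparatePos.affF B 1 u' z ∧ SeparatePos.affF B 1 u' z < SeparatePos.affF B 1 v' z) → (∀ z : Fin (B + 1 + 1) → ℝ, (∀ j, 0 < SeparatePos.affF B 1 (M' j) z) ↔ ((∀ j, 0 < SeparatePos.affB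 B 1 (M₀' j) z) ∧ SeparatePos.affB B 1 ylo' z < z (Fin.castAdd 1 (Fin.last B)) ∧ z (Fin.castAdd 1 (Fin.last B)) < SeparatePos.affB B 1 yhi' z)) → (∀ z : Fin (B + 1 + 1) → ℝ, (∀ j, 0 < SeparatePos.affB B 1 (M₀' j) z) → SeparatePos.affB B 1 ylo' z < SeparatePos.affB B 1 yhi' z) → (∀ z : Fin (B + 1 + 1) → ℝ, (∀ j, 0 < SeparatePos.affB B 1 (M₀' j) z) → (0 < u'.1 (Fin.last B) → SeparatePos.affB B 1 ℓ₂ z ≤ SeparatePos.affB B 1 ylo' z) ∧ (u'.1 (Fin.last B) < 0 → SeparatePos.affB B 1 yhi' z ≤ SeparatePos.affB B 1 ℓ₂ z)) → (∀ z : Fin (B + 1 + 1) → ℝ, (∀ j, 0 < SeparatePos.affB B 1 (M₀' j) z) → SeparatePos.affF B 1 v' z - SeparatePos.affF B 1 u' z < ε * (SeparatePos.affB B 1 yhi' z - SeparatePos.affB B 1 ylo' z)) → ((∃ δ : ℝ, 0 < δ ∧ ∀ z : Fin (B + 1 + 1) → ℝ, (∀ j, 0 < SeparatePos.affB B 1 (M₀'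 j) z) → δ ≤ |SeparatePos.affB B 1 ylo' z - SeparatePos.affB B 1 ℓ₂ z| ∧ δ ≤ |SeparatePos.affB B 1 yhi' z - SeparatePos.affB B 1 ℓ₂ z|) ∧ (∃ z ∈ closure {z : Fin (B + 1 + 1) → ℝ | ∀ j, 0 < SeparatePos.affF B 1 (M' j) z}, SeparatePos.affB B 1 ylo' z = SeparatePos.affB B 1 yhi' z ∧ SeparatePos.affF B 1 u' z = SeparatePos.affF B 1 v' z ∧ SeparatePos.affB B 1 (SeparatePos.restr B u') z + (u'.1 (Fin.last B) : ℝ) * SeparatePos.affB B 1 ℓ₂ z = 0) ∨ (∃ z ∈ closure {z : Fin (B + 1 + 1) → ℝ | ∀ j, 0 < SeparatePos.affF B 1 (M' j) z}, SeparatePos.affB B 1 ylo' z = SeparatePos.affB B 1 yhi' z ∧ SeparatePos.affF B 1 u' z = SeparatePos.affF B 1 v' z ∧ SeparatePos.affB B 1 (SeparatePos.restr B u') z + (u'.1 (Fin.last B) : ℝ) * SeparatePos.affB B 1 ℓ₂ z = 0 ∧ SeparatePos.affB B 1 ylo' z = SeparatePos.affB B 1 ℓ₂ z)) → ∃ c ∈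 AddSubgroup.closure (SeparatePos.GGset B 2 1), KZ.of s' - c ∈ KZ.relations) : ∃ c ∈ AddSubgroup.closure (SeparatePos.GGset B 2 1), KZ.of s - c ∈ KZ.relations :=
  RebasePos.good_dthick_of_HUQ L e ℓ₁ ℓ₂ ε hε s M p u v κ A hbd hdom hint hκ hA hA0 hcell HUQ

/-- **The stub `stub_rebaseSimplePosOnePos` in every dimension from the thin-cell residues
alone** (exactly its signature plus `ε`, `hε`, `HUQ` at base dimension `b + 2`; compare
`rebaseSimplePosOnePos_of_thinQuad'`, whose `Hdthick`, `Hdfar` are discharged by part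
`DCornerPar`). -/
theorem rebaseSimplePosOnePos_of_HUQ' (GS : ℕ → ℕ → Set KZ.FormalRep) (GG : ℕ → ℕ → ℕ → Set KZ.FormalRep) (hGS : ∀ b k, GS b k = {w : KZ.FormalRep | ∃ (m m' n₁ n₂ : ℕ) (s : KZ.IntegralRep (b + 1 + k)) (M : Fin m' → (Fin (b + 1) → ℚ) × ℚ) (L : Fin m → (Fin b → ℚ) × ℚ) (e : Fin m → ℕ) (p : MvPolynomial (Fin b) ℚ) (ℓ₁ ℓ₂ : (Fin b → ℚ) × ℚ) (a : Fin k → Option ((Fin (b + 1) → ℚ) × ℚ)) (lo hi : Fin k → Fin k ⊕ ((Fin (b + 1) → ℚ) × ℚ)), (n₁ = 0 ∨ n₂ = 0) ∧ n₂ = 1 ∧ Bornology.IsBounded s.domain ∧ s.domain = {z | (∀ j, 0 < ∑ i, ((M j).1 i : ℝ) * z (Fin.castAdd k i) + ((M j).2 : ℝ)) ∧ ∀ i, Sum.elim (fun j => z (Fin.natAdd (b + 1) j)) (fun c => ∑ i', (c.1 i' : ℝ) * z (Fin.castAdd k i') + (c.2 : ℝ)) (lo i) < z (Fin.natAdd (b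 + 1) i) ∧ z (Fin.natAdd (b + 1) i) < Sum.elim (fun j => z (Fin.natAdd (b + 1) j)) (fun c => ∑ i', (c.1 i' : ℝ) * z (Fin.castAdd k i') + (c.2 : ℝ)) (hi i)} ∧ EqOn s.integrand (fun z => MvPolynomial.aeval (fun i => z (Fin.castAdd k (Fin.castSucc i))) p / (∏ j, (∑ i, ((L j).1 i : ℝ) * z (Fin.castAdd k (Fin.castSucc i)) + ((L j).2 : ℝ)) ^ e j) * ((z (Fin.castAdd k (Fin.last b)) - (∑ i, (ℓ₁.1 i : ℝ) * z (Fin.castAdd k (Fin.castSucc i)) + (ℓ₁.2 : ℝ))) ^ n₁ / (z (Fin.castAdd k (Fin.last b)) - (∑ i, (ℓ₂.1 i : ℝ) * z (Fin.castAdd k (Fin.castSucc i)) + (ℓ₂.2 : ℝ))) ^ n₂) * ∏ i, (a i).elim 1 (fun c => 1 / (z (Fin.natAdd (b + 1) i) - (∑ i', (c.1 i' : ℝ) * z (Fin.castAdd k i') + (c.2 : ℝ))))) s.domain ∧ w = KZ.of s}) (hGG : ∀ b σ k, GG b σ k = {w : KZ.FormalRep | ∃ (m m' n₁ n₂ : ℕ)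 (s : KZ.IntegralRep (b + 1 + k)) (M : Fin m' → (Fin (b + 1) → ℚ) × ℚ) (L : Fin m → (Fin b → ℚ) × ℚ) (e : Fin m → ℕ) (p : MvPolynomial (Fin b) ℚ) (ℓ₁ ℓ₂ : (Fin b → ℚ) × ℚ) (a : Fin k → Option ((Fin (b + 1) → ℚ) × ℚ)) (lo hi : Fin k → Fin k ⊕ ((Fin (b + 1) → ℚ) × ℚ)), (n₁ = 0 ∨ n₂ = 0) ∧ (σ = 2 → (∀ i c, a i = some c → c.1 (Fin.last b) = 0) ∧ (∀ i c, (lo i = Sum.inr c ∨ hi i = Sum.inr c) → (c.1 (Fin.last b) = 0 ∨ c = (Pi.single (Fin.last b) 1, 0)))) ∧ Bornology.IsBounded s.domain ∧ s.domain = {z | (∀ j, 0 < ∑ i, ((M j).1 i : ℝ) * z (Fin.castAdd k i) + ((M j).2 : ℝ)) ∧ ∀ i, Sum.elim (fun j => z (Fin.natAdd (b + 1) j)) (fun c => ∑ i', (c.1 i' : ℝ) * z (Fin.castAdd k i') + (c.2 : ℝ)) (lo i) < z (Fin.natAdd (b + 1) i) ∧ z (Fin.natAdd (b + 1) i) < Sum.elim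 (fun j => z (Fin.natAdd (b + 1) j)) (fun c => ∑ i', (c.1 i' : ℝ) * z (Fin.castAdd k i') + (c.2 : ℝ)) (hi i)} ∧ EqOn s.integrand (fun z => MvPolynomial.aeval (fun i => z (Fin.castAdd k (Fin.castSucc i))) p / (∏ j, (∑ i, ((L j).1 i : ℝ) * z (Fin.castAdd k (Fin.castSucc i)) + ((L j).2 : ℝ)) ^ e j) * ((z (Fin.castAdd k (Fin.last b)) - (∑ i, (ℓ₁.1 i : ℝ) * z (Fin.castAdd k (Fin.castSucc i)) + (ℓ₁.2 : ℝ))) ^ n₁ / (z (Fin.castAdd k (Fin.last b)) - (∑ i, (ℓ₂.1 i : ℝ) * z (Fin.castAdd k (Fin.castSucc i)) + (ℓ₂.2 : ℝ))) ^ n₂) * ∏ i, (a i).elim 1 (fun c => 1 / (z (Fin.natAdd (b + 1) i) - (∑ i', (c.1 i' : ℝ) * z (Fin.castAdd k i') + (c.2 : ℝ))))) s.domain ∧ w = KZ.of s}) (JJ : ℕ → ℕ → Set KZ.FormalRep) (JD : ℕ → Set KZ.FormalRep) (hJJ : ∀ b k, JJ b k = {w : KZ.FormalRep | ∃ (m m'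 : ℕ) (s : KZ.IntegralRep (b + k)) (M : Fin m' → (Fin b → ℚ) × ℚ) (L : Fin m → (Fin b → ℚ) × ℚ) (e : Fin m → ℕ) (p : MvPolynomial (Fin b) ℚ) (a : Fin k → Option ((Fin b → ℚ) × ℚ)) (lo hi : Fin k → Fin k ⊕ ((Fin b → ℚ) × ℚ)), Bornology.IsBounded s.domain ∧ s.domain = {z | (∀ j, 0 < ∑ i, ((M j).1 i : ℝ) * z (Fin.castAdd k i) + ((M j).2 : ℝ)) ∧ ∀ i, Sum.elim (fun j => z (Fin.natAdd b j)) (fun c => ∑ i', (c.1 i' : ℝ) * z (Fin.castAdd k i') + (c.2 : ℝ)) (lo i) < z (Fin.natAdd b i) ∧ z (Fin.natAdd b i) < Sum.elim (fun j => z (Fin.natAdd b j)) (fun c => ∑ i', (c.1 i' : ℝ) * z (Fin.castAdd k i') + (c.2 : ℝ)) (hi i)} ∧ EqOn s.integrand (fun z => MvPolynomial.aeval (fun i => z (Fin.castAdd k i)) p / (∏ j, (∑ i, ((L j).1 i : ℝ) * z (Fin.castAdd k i) + ((L j).2 : ℝ)) ^ e j) * ∏ i, (a i).elim 1 (fun c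 => 1 / (z (Fin.natAdd b i) - (∑ i', (c.1 i' : ℝ) * z (Fin.castAdd k i') + (c.2 : ℝ))))) s.domain ∧ w = KZ.of s}) (hJD : ∀ N, JD N = {w : KZ.FormalRep | ∃ b' k', b' + k' = N ∧ w ∈ JJ b' k'}) (b : ℕ) (ε : ℚ) (hε : 0 < ε) (HUQ : ∀ (m : ℕ) (L : Fin m → (Fin (b + 1 + 1) → ℚ) × ℚ) (e : Fin m → ℕ) (ℓ₁ ℓ₂ : (Fin (b + 1 + 1) → ℚ) × ℚ) (p : MvPolynomial (Fin (b + 1 + 1)) ℚ) (u v : (Fin (b + 1 + 1 + 1) → ℚ) × ℚ), u.1 (Fin.last (b + 1 + 1)) ≠ 0 → u.1 (Fin.last (b + 1 + 1)) = v.1 (Fin.last (b + 1 + 1)) → ∀ (m'' m₀' : ℕ) (s' : KZ.IntegralRep ((b + 1 + 1) + 1 + 1)) (M' : Fin m'' → (Fin (b + 1 + 1 + 1) → ℚ) × ℚ) (M₀' : Fin m₀' → (Fin (b + 1 + 1) → ℚ) × ℚ) (ylo' yhi' : (Fin (b + 1 + 1) → ℚ) × ℚ), Bornology.IsBounded s'.domain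 → s'.domain = SeparatePos.gDom (b + 1 + 1) 1 m'' M' (fun _ => Sum.inr u) (fun _ => Sum.inr v) → EqOn s'.integrand (RebasePos.glit (b + 1 + 1) 1 p L e ℓ₁ ℓ₂ 0 1 (fun _ => some 0)) s'.domain → (∀ z : Fin (b + 1 + 1 + 1 + 1) → ℝ, (∀ j, 0 < SeparatePos.affF (b + 1 + 1) 1 (M' j) z) → 0 < SeparatePos.affF (b + 1 + 1) 1 u z ∧ SeparatePos.affF (b + 1 + 1) 1 u z < SeparatePos.affF (b + 1 + 1) 1 v z) → (∀ z : Fin (b + 1 + 1 + 1 + 1) → ℝ, (∀ j, 0 < SeparatePos.affF (b + 1 + 1) 1 (M' j) z) ↔ ((∀ j, 0 < SeparatePos.affB (b + 1 + 1) 1 (M₀' j) z) ∧ SeparatePos.affB (b + 1 + 1) 1 ylo' z < z (Fin.castAdd 1 (Fin.last (b + 1 + 1))) ∧ z (Fin.castAdd 1 (Fin.last (b + 1 + 1))) < SeparatePos.affB (b + 1 + 1) 1 yhi' z)) → (∀ z : Fin (b + 1 + 1 + 1 + 1) → ℝ, (∀ j, 0 < SeparatePos.affB (b + 1 + 1) 1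 (M₀' j) z) → SeparatePos.affB (b + 1 + 1) 1 ylo' z < SeparatePos.affB (b + 1 + 1) 1 yhi' z) → (∀ z : Fin (b + 1 + 1 + 1 + 1) → ℝ, (∀ j, 0 < SeparatePos.affB (b + 1 + 1) 1 (M₀' j) z) → (0 < u.1 (Fin.last (b + 1 + 1)) → SeparatePos.affB (b + 1 + 1) 1 ℓ₂ z ≤ SeparatePos.affB (b + 1 + 1) 1 ylo' z) ∧ (u.1 (Fin.last (b + 1 + 1)) < 0 → SeparatePos.affB (b + 1 + 1) 1 yhi' z ≤ SeparatePos.affB (b + 1 + 1) 1 ℓ₂ z)) → (∀ z : Fin (b + 1 + 1 + 1 + 1) → ℝ, (∀ j, 0 < SeparatePos.affB (b + 1 + 1) 1 (M₀' j) z) → SeparatePos.affF (b + 1 + 1) 1 v z - SeparatePos.affF (b + 1 + 1) 1 u z < ε * (SeparatePos.affB (b + 1 + 1) 1 yhi' z - SeparatePos.affB (b + 1 + 1) 1 ylo' z)) → ((∃ δ : ℝ, 0 < δ ∧ ∀ z : Fin (b + 1 + 1 + 1 + 1) → ℝ, (∀ j, 0 < SeparatePos.affB (b + 1 + 1) 1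 (M₀' j) z) → δ ≤ |SeparatePos.affB (b + 1 + 1) 1 ylo' z - SeparatePos.affB (b + 1 + 1) 1 ℓ₂ z| ∧ δ ≤ |SeparatePos.affB (b + 1 + 1) 1 yhi' z - SeparatePos.affB (b + 1 + 1) 1 ℓ₂ z|) ∧ (∃ z ∈ closure {z : Fin (b + 1 + 1 + 1 + 1) → ℝ | ∀ j, 0 < SeparatePos.affF (b + 1 + 1) 1 (M' j) z}, SeparatePos.affB (b + 1 + 1) 1 ylo' z = SeparatePos.affB (b + 1 + 1) 1 yhi' z ∧ SeparatePos.affF (b + 1 + 1) 1 u z = SeparatePos.affF (b + 1 + 1) 1 v z ∧ SeparatePos.affB (b + 1 + 1) 1 (SeparatePos.restr (b + 1 + 1) u) z + (u.1 (Fin.last (b + 1 + 1)) : ℝ) * SeparatePos.affB (b + 1 + 1) 1 ℓ₂ z = 0)) ∨ (∃ z ∈ closure {z : Fin (b + 1 + 1 + 1 + 1) → ℝ | ∀ j, 0 < SeparatePos.affF (b + 1 + 1) 1 (M' j) z}, SeparatePos.affB (b + 1 + 1) 1 ylo' z = SeparatePos.affB (b + 1 + 1) 1 yhi' z ∧ SeparatePos.affF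 (b + 1 + 1) 1 u z = SeparatePos.affF (b + 1 + 1) 1 v z ∧ SeparatePos.affB (b + 1 + 1) 1 (SeparatePos.restr (b + 1 + 1) u) z + (u.1 (Fin.last (b + 1 + 1)) : ℝ) * SeparatePos.affB (b + 1 + 1) 1 ℓ₂ z = 0 ∧ SeparatePos.affB (b + 1 + 1) 1 ylo' z = SeparatePos.affB (b + 1 + 1) 1 ℓ₂ z) → ∃ c ∈ AddSubgroup.closure (SeparatePos.GGset (b + 1 + 1) 2 1), KZ.of s' - c ∈ KZ.relations) : ∀ x ∈ GS (b + 2) 1, ∃ c ∈ AddSubgroup.closure (GG (b + 2) 2 1 ∪ JJ (b + 2) 2 ∪ JD (b + 3)), x - c ∈ KZ.relations :=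
  rebaseSimplePosOnePos_of_thinQuad' GS GG hGS hGG JJ JD hJJ hJD b ε hε HUQ
    (fun m L e ℓ₁ ℓ₂ _ s M p u v κ A hbd hdom hint hκ hA hA0 hcell _ =>
      RebasePos.good_dthick_of_par L e ℓ₁ ℓ₂ s M p u v κ A hbd hdom hint hκ hA hA0 hcell
        fun _ s' M' u' v' hbd' hdom' hint' hu' hpar' hcell' =>
          RebasePos.good_par_of_thinQuad L e ℓ₁ ℓ₂ ε hε s' M' p u' v' hbd' hdom' hint' hu' hpar' hcell'
            (fun m'' m₀' s'' M'' M₀' ylo' yhi' hbd'' hdom'' hint'' hcell'' hsec' hne' hfar' hthin' hδ htr =>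
              HUQ m L e ℓ₁ ℓ₂ p u' v' hu' hpar' m'' m₀' s'' M'' M₀' ylo' yhi' hbd'' hdom'' hint'' hcell'' hsec' hne'
                hfar' hthin' (Or.inl ⟨hδ, htr⟩))
            (fun m'' m₀' s'' M'' M₀' ylo' yhi' hbd'' hdom'' hint'' hcell'' hsec' hne' hfar' hthin' hq =>
              HUQ m L e ℓ₁ ℓ₂ p u' v' hu' hpar' m'' m₀' s'' M'' M₀' ylo' yhi' hbd'' hdom'' hint'' hcell'' hsec' hne'
                hfar' hthin' (Or.inr hq)))
    (fun m L e ℓ₁ ℓ₂ _ s M p u v κ A hbd hdom hint hκ hA hA0 hcell _ =>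
      RebasePos.good_dfar_of_par L e ℓ₁ ℓ₂ s M p u v κ A hbd hdom hint hκ hA hA0 hcell
        fun _ s' M' u' v' hbd' hdom' hint' hu' hpar' hcell' =>
          RebasePos.good_par_of_thinQuad L e ℓ₁ ℓ₂ ε hε s' M' p u' v' hbd' hdom' hint' hu' hpar' hcell'
            (fun m'' m₀' s'' M'' M₀' ylo' yhi' hbd'' hdom'' hint'' hcell'' hsec' hne' hfar' hthin' hδ htr =>
              HUQ m L e ℓ₁ ℓ₂ p u' v' hu' hpar' m'' m₀' s'' M'' M₀' ylo' yhi' hbd'' hdom'' hint'' hcell'' hsec' hne'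
                hfar' hthin' (Or.inl ⟨hδ, htr⟩))
            (fun m'' m₀' s'' M'' M₀' ylo' yhi' hbd'' hdom'' hint'' hcell'' hsec' hne' hfar' hthin' hq =>
              HUQ m L e ℓ₁ ℓ₂ p u' v' hu' hpar' m'' m₀' s'' M'' M₀' ylo' yhi' hbd'' hdom'' hint'' hcell'' hsec' hne'
                hfar' hthin' (Or.inr hq)))

end Summit.KontsevichZagierPeriods.ArrangementNormalForm.JanusBands
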